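import Literature.AlgebraicGeometry.Resolution.HasseSchmidtCoefficients
import Literature.AlgebraicGeometry.Resolution.HasseSchmidtLinearSubstitution
import Mathlib.FieldTheory.Perfect
import Mathlib.Data.Nat.Choose.Lucas
import Mathlib.LinearAlgebra.LinearIndependent.Lemmas
import Mathlib.LinearAlgebra.Dimension.Constructions
import Mathlib.Data.Fin.Tuple.Sort
import HarnessLib

/-!
# Graded, differentially stable subalgebras of a polynomial ring over a perfect field
# (Hironaka 1970; Giraud 1975, Lemme 1.6; Kawanoue 2007, Lemma 3.1.2.1)

Topic: `Literature/AlgebraicGeometry/Resolution`. Let `K` be a PERFECT field of exponential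
characteristic `p` (`p = 1` in characteristic `0`) and `U ⊆ K[x_1, …, x_n]` a graded
`K`-subalgebra which is stable under all Hasse–Schmidt derivations `D^{(β)}`
(`IsGradedSubalgebra U`, `IsDiffStable U` of `HasseSchmidtCoefficients.lean`).

> **Kawanoue 2007, Lemma 3.1.2.1** (`k` algebraically closed of characteristic `p ≥ 0` there, p. 25;
> the proof uses only that `k` is perfect). "Let `L = ⊕_{n ≥ 0} L_n ⊂ G` [`= k[x_1, …, x_d]`] be a
> graded `k`-subalgebra of `G` with `L_0 = G_0 = k`. Suppose that `L` is 𝔇-saturated in the sense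
> that it satisfies the following condition: `f ∈ L, ∂ ∈ Diff_G ⟹ ∂(f) ∈ L`. Then `L` is generated
> as a graded algebra over `k` by its pure part `L^pure := ⊔_{e ≥ 0} L^pure_{p^e}` where
> `L^pure_{p^e} = L_{p^e} ∩ F^e(G_1)` … In particular, we have `L = k[⊔_{i=1}^N F^{e_i}(V_i)]`
> with `Σ_{i=1}^N #V_i ≤ d`." (`F` = Frobenius, `G_1` = the linear forms, the `F^{e_i}(V_i)`
> `k`-linearly independent.)
>
> **Giraud 1975, §1.6 (3), after Hironaka 1970** (paraphrase): the algebra of invariants `U` of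
> the ridge is generated by additive homogeneous polynomials `σ_i` which, after reordering the
> variables, form a triangular system `σ_i = X_i^{q(i)} + Σ_{j>i} c_{ij} X_j^{q(i)}`,
> "`q(1) ≤ q(2) ≤ … ≤ q(e)`, où les `q(i)` sont des puissances de l'exposant caractéristique du
> corps de base" (p. 205); over a PERFECT field each `σ_i` is the `q(i)`-th power of a linear form.

This is input **(I3)** of the review packet of Hironaka's 2017 manuscript
(`Literature/AlgebraicGeometry/Hironaka2017/EdgeHilbert.lean`, header: "Hironaka 1970 / Giraud
1975 for the structure of differentially stable graded subalgebras … the edge algebra is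
`G(ξ) = κ[ℓ₁^{q₁}, …, ℓ_r^{q_r}]`"; manuscript p. 19 (8) "each `ḡ_j` … is an element of
`ρ^{e_j}(K[z̄])` … `G` must be Diff-closed", p. 21 (25) "`f_j = x_j^{q_j}`"), there a CITED
input; here it is proved for perfect `K` (the residue field at a closed point of a variety over a
perfect ground field is perfect).

## Main statements (everything proved, no named facts)

* **`exists_eq_adjoin_pow_linearForms_of_isDiffStable`**: there are `K`-linearly independent
  linear forms `ℓ_1, …, ℓ_r ∈ Σ K x_i` and exponents `e_1 ≤ … ≤ e_r` with
  `U = K[ℓ_1^{p^{e_1}}, …, ℓ_r^{p^{e_r}}]` (`Algebra.adjoin`);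
  `exists_eq_adjoin_pow_linearForms_of_isDiffStable'` adds `r ≤ #σ` and `ℓ_j` homogeneous of
  degree `1`; `exists_eq_adjoin_pow_linearForms_of_isDiffStable_fin` is the `K[x_1, …, x_n]` form
  (`ℓ_j ∈ homogeneousSubmodule (Fin n) K 1`, `r ≤ n`).
* The induction (`exists_adjoin_pow_linearForm_eq_aux`, on the finite set `S` of variables with
  `U ⊆ K[x_j : j ∈ S]`) and its key lemmas, for the least positive degree `q` in which `U` has a
  nonzero form `g₀`:
  1. `support_subset_single_of_minDeg` — every monomial of a degree-`q` form of `U` is `x_i^q`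
     (else some `D^{(e_i)}` produces a nonzero form of degree `q - 1` in `U`);
  2. `exists_eq_pow_of_minDeg` — `q = p^e` (if `q` is not a `p`-power, Lucas/Kummer give `k < q`
     with `(q choose k) ≠ 0` in `K`, and `D^{(k e_i)} x_i^q ≠ 0` has degree `0 < q - k < q`);
     hence `g₀ = (Σ c_i x_i)^{p^e}` by perfectness (`sum_C_mul_X_pow_eq_linearForm_pow`);
  3. `dvd_of_mem_support_of_minDeg` — `p^e` divides every exponent of every element of `U`;
  4. `le_adjoin_insert_X_pow_of_minDeg` — once `x_{i₀}^{p^e} ∈ U`: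
     `U ⊆ K[x_{i₀}^{p^e}][U ∩ K[x_j : j ≠ i₀]]`, by peeling off the top `x_{i₀}`-layer, which is
     the Hasse–Schmidt derivative `D^{(t e_{i₀})} f ∈ U` (`hasseDeriv_single_eq_coeffX`);
  after the tilt `x_{i₀} ↦ x_{i₀} - Σ_{j ≠ i₀} v_j x_j` moving `Σ c_i x_i` to a multiple of
  `x_{i₀}` (`HasseSchmidtLinearSubstitution.lean`; `IsDiffStable.map_lsubst`), one inducts on
  `U ∩ K[x_j : j ≠ i₀]` and pulls back.
* `choose_pow_mul_add_modEq_one`, `cast_choose_pow_mul_add_ne_zero`,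
  `exists_eq_pow_of_cast_choose_eq_zero` — the two binomial facts modulo `p` used, from Mathlib's
  Lucas theorem (`Choose.choose_modEq_choose_mod_mul_choose_div_nat`) and its corollary
  `Choose.eq_pow_multiplicity_of_choose_modEq_zero_nat` (`(n choose k) ≡ 0 (mod p)` for all
  `0 < k < n` forces `n` to be a power of `p`).

Proof route: an elementary coefficient-calculus induction on the number of variables (ours); it
differs from Kawanoue's (Frobenius roots `L^{[1/p]}`) and from Hironaka's/Oda's (group schemes),
but proves the identical statement. Deliberately NOT here: the non-perfect case (Hironaka's
general triangular form `σ_i = Σ_j c_{ij} x_j^{q_i}` with `c_{ij} ∈ K`, Giraud Lemme 1.7), the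
scheme `B_U = Spec K[x]/U_+ K[x]` and representability of the ridge functor (`Ridge.lean`).

## References

* H. Kawanoue, *Toward resolution of singularities over a field of positive characteristic.
  Part I. Foundation; the language of the idealistic filtration*, Publ. RIMS 43 (2007) 819–909
  (arXiv:math/0607009), Definition 3.1.1.1, Lemma 3.1.2.1 and its proof. [Kawanoue2007]
* H. Hironaka, *Additive groups associated with points of a projective space*, Ann. of Math. 92
  (1970) 327–334. [Hironaka1970AdditiveGroups]
* J. Giraud, *Contact maximal en caractéristique positive*, Ann. Sci. ÉNS (4) 8 (1975) 201–234,
  §1.5 (3), Lemme 1.6, Lemme 1.7. [Giraud1975]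
* T. Oda, *Hironaka's additive group scheme II*, Publ. RIMS 19 (1983) 1163–1179 (background).
  [Oda1983HironakaGroupSchemeII]
-/

open MvPolynomial

namespace Literature.AlgebraicGeometry.Resolution

section Binomial

/-! ### Two binomial facts modulo `p` -/

/-- Lucas: `(p^e a + b choose p^e a) ≡ 1 (mod p)` for `b < p^e`. [folklore] -/
theorem choose_pow_mul_add_modEq_one {p : ℕ} (hp : p.Prime) (a : ℕ) :
    ∀ (e b : ℕ), b < p ^ e → (p ^ e * a + b).choose (p ^ e * a) ≡ 1 [MOD p] := by
  haveI := Fact.mk hp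
  intro e
  induction e with
  | zero =>
    intro b hb
    have hb0 : b = 0 := by simpa using hb
    subst hb0
    simp [Nat.ModEq.refl]
  | succ e ih =>
    intro b hb
    have hk : p ^ (e + 1) * a = p * (p ^ e * a) := by ring
    have step := Choose.choose_modEq_choose_mod_mul_choose_div_nat (n := p ^ (e + 1) * a + b)
      (k := p ^ (e + 1) * a) (p := p)
    have h1 : (p ^ (e + 1) * a) % p = 0 := by rw [hk, Nat.mul_mod_right]
    have h2 : (p ^ (e + 1) * a) / p = p ^ e * a := by
      rw [hk, Nat.mul_div_cancel_left _ hp.pos]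
    have h3 : (p ^ (e + 1) * a + b) / p = p ^ e * a + b / p := by
      rw [hk, Nat.mul_add_div hp.pos]
    have hb' : b / p < p ^ e := by
      rw [Nat.div_lt_iff_lt_mul hp.pos]; simpa [pow_succ] using hb
    rw [h1, h2, h3, Nat.choose_zero_right, one_mul] at step
    exact step.trans (ih (b / p) hb')

/-- In a field of exponential characteristic `p`: `(p^e a + b choose p^e a) ≠ 0` for `b < p^e`.
[folklore] -/
theorem cast_choose_pow_mul_add_ne_zero (K : Type*) [Field K] (p : ℕ) [ExpChar K p]
    {e a b : ℕ} (hb : b < p ^ e) : ((p ^ e * a + b).choose (p ^ e * a) : K) ≠ 0 := by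
  cases ‹ExpChar K p› with
  | zero =>
    have hb0 : b = 0 := by simpa using hb
    subst hb0
    simp
  | prime hp =>
    have h := choose_pow_mul_add_modEq_one hp a e b hb
    intro h0
    rw [CharP.cast_eq_zero_iff K p] at h0
    have : 1 ≡ 0 [MOD p] := h.symm.trans (Nat.modEq_zero_iff_dvd.mpr h0)
    have := Nat.modEq_zero_iff_dvd.mp this
    exact hp.one_lt.ne' (Nat.dvd_one.mp this)

/-- In a field of exponential characteristic `p`: if all the middle binomial coefficients
`(q choose k)`, `0 < k < q`, vanish, then `q` is a power of `p`. [folklore] -/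
theorem exists_eq_pow_of_cast_choose_eq_zero (K : Type*) [Field K] (p : ℕ) [ExpChar K p]
    {q : ℕ} (hq : 0 < q) (h : ∀ k, 0 < k → k < q → (q.choose k : K) = 0) : ∃ e, q = p ^ e := by
  cases ‹ExpChar K p› with
  | zero =>
    refine ⟨0, ?_⟩
    by_contra hq1
    have h1 := h 1 Nat.one_pos (by rw [pow_zero] at hq1; omega)
    rw [Nat.choose_one_right, Nat.cast_eq_zero] at h1
    omega
  | prime hp =>
    haveI := Fact.mk hp
    refine ⟨multiplicity p q, Choose.eq_pow_multiplicity_of_choose_modEq_zero_nat hq ?_⟩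
    intro i hi
    rw [Finset.mem_Icc] at hi
    have := h i hi.1 (by omega)
    rw [CharP.cast_eq_zero_iff K p] at this
    exact Nat.modEq_zero_iff_dvd.mpr this

end Binomial

section Structure

/-! ### Transport of gradedness and differential stability under linear substitutions -/

variable {σ : Type*} [Fintype σ] [DecidableEq σ] {R : Type*} [CommRing R]

omit [DecidableEq σ] in
/-- A linear substitution maps graded subalgebras to graded subalgebras. [folklore] -/
theorem IsGradedSubalgebra.map_lsubst {U : Subalgebra R (MvPolynomial σ R)}
    (hU : IsGradedSubalgebra U) (a : σ → σ → R) : IsGradedSubalgebra (U.map (lsubst R a)) := by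
  intro g hg d
  obtain ⟨f, hf, rfl⟩ := Subalgebra.mem_map.mp hg
  rw [homogeneousComponent_lsubst]
  exact Subalgebra.mem_map.mpr ⟨_, hU f hf d, rfl⟩

omit [DecidableEq σ] in
/-- A linear substitution maps differentially stable subalgebras to differentially stable
subalgebras. [folklore] -/
theorem IsDiffStable.map_lsubst {U : Subalgebra R (MvPolynomial σ R)}
    (hU : IsDiffStable U) (a : σ → σ → R) : IsDiffStable (U.map (lsubst R a)) := by
  intro g hg β
  obtain ⟨f, hf, rfl⟩ := Subalgebra.mem_map.mp hg
  exact hasseDeriv_lsubst_mem_map R a hU hf β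

omit [DecidableEq σ] in
/-- The "no forms in degrees `0 < d < q`" property passes to the image under a linear
substitution (of a graded subalgebra). [folklore] -/
theorem minDeg_map_lsubst {U : Subalgebra R (MvPolynomial σ R)} (hU : IsGradedSubalgebra U)
    (a : σ → σ → R) {q : ℕ}
    (hmin : ∀ d, 0 < d → d < q → ∀ g ∈ U, g.IsHomogeneous d → g = 0) :
    ∀ d, 0 < d → d < q → ∀ g ∈ U.map (lsubst R a), g.IsHomogeneous d → g = 0 := by
  intro d hd hdq g hg hgh
  obtain ⟨f, hf, rfl⟩ := Subalgebra.mem_map.mp hg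
  have h1 : homogeneousComponent d (lsubst R a f) = lsubst R a f := by
    rw [homogeneousComponent_of_mem hgh, if_pos rfl]
  rw [← h1, homogeneousComponent_lsubst,
    hmin d hd hdq _ (hU f hf d) (homogeneousComponent_isHomogeneous d f), map_zero]

/-! ### The form of minimal positive degree is a `q`-th power of a linear form, `q = p^e` -/

variable {K : Type*} [Field K]

omit [Fintype σ] in
/-- **Key lemma 1.** In a differentially stable `U` with no forms in degrees `0 < d < q`, every
monomial of a form of degree `q` in `U` is a `q`-th power of a variable.
[cite: Kawanoue2007, Lemma 3.1.2.1 (proof)] -/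
theorem support_subset_single_of_minDeg {U : Subalgebra K (MvPolynomial σ K)}
    (hUd : IsDiffStable U) {q : ℕ} (hq : 0 < q)
    (hmin : ∀ d, 0 < d → d < q → ∀ g ∈ U, g.IsHomogeneous d → g = 0)
    {f : MvPolynomial σ K} (hf : f ∈ U) (hfh : f.IsHomogeneous q) :
    ∀ α ∈ f.support, ∃ i, α = Finsupp.single i q := by
  intro α hα
  have hdeg : α.degree = q := degree_eq_of_mem_support hfh hα
  have hα0 : α ≠ 0 := by rintro rfl; rw [map_zero] at hdeg; omega
  obtain ⟨i, hi⟩ : ∃ i, α i ≠ 0 := by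
    by_contra h
    push Not at h
    exact hα0 (Finsupp.ext h)
  set k := α i with hk
  have hD : hasseDeriv K (Finsupp.single i k) f ∈ U := hUd f hf _
  have hDh : (hasseDeriv K (Finsupp.single i k) f).IsHomogeneous (q - k) :=
    isHomogeneous_hasseDeriv_single K hfh i k
  have hmem : α.erase i ∈ (hasseDeriv K (Finsupp.single i k) f).support := by
    rw [mem_support_iff, coeff_hasseDeriv_single, Finsupp.erase_same, zero_add, Nat.choose_self,
      Nat.cast_one, one_mul, Finsupp.erase_add_single]
    exact mem_support_iff.mp hα
  by_cases hkq : k < q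
  · exfalso
    have h0 := hmin (q - k) (by omega) (by omega) _ hD hDh
    rw [h0, support_zero] at hmem
    exact Finset.notMem_empty _ hmem
  · have h0 : (α.erase i).degree = 0 := by
      rw [degree_eq_of_mem_support hDh hmem]; omega
    rw [Finsupp.degree_eq_zero_iff] at h0
    have hαe : α = Finsupp.single i k := by rw [← Finsupp.erase_add_single i α, h0, zero_add]
    refine ⟨i, ?_⟩
    rw [hαe, Finsupp.degree_single] at hdeg
    rw [hαe, hdeg]

omit [Fintype σ] in
/-- **Key lemma 2.** In the situation of key lemma 1, if `U` contains a nonzero form of degree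
`q`, then `q` is a power of the exponential characteristic (all middle binomial coefficients
`(q choose k)` vanish in `K`). [cite: Kawanoue2007, Lemma 3.1.2.1] [cite: Giraud1975, §1.6 (3)] -/
theorem exists_eq_pow_of_minDeg (p : ℕ) [ExpChar K p] {U : Subalgebra K (MvPolynomial σ K)}
    (hUd : IsDiffStable U) {q : ℕ} (hq : 0 < q)
    (hmin : ∀ d, 0 < d → d < q → ∀ g ∈ U, g.IsHomogeneous d → g = 0)
    {f : MvPolynomial σ K} (hf : f ∈ U) (hfh : f.IsHomogeneous q) (hf0 : f ≠ 0) :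
    ∃ e, q = p ^ e := by
  obtain ⟨α, hα⟩ := exists_coeff_ne_zero hf0
  obtain ⟨i, rfl⟩ :=
    support_subset_single_of_minDeg hUd hq hmin hf hfh α (mem_support_iff.mpr hα)
  refine exists_eq_pow_of_cast_choose_eq_zero K p hq fun k hk hkq => ?_
  have hD := hmin (q - k) (by omega) (by omega) _ (hUd f hf (Finsupp.single i k))
    (isHomogeneous_hasseDeriv_single K hfh i k)
  have := congr_arg (coeff (Finsupp.single i (q - k))) hD
  rw [coeff_hasseDeriv_single, coeff_zero, Finsupp.single_eq_same, ← Finsupp.single_add,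
    Nat.sub_add_cancel hkq.le, mul_eq_zero] at this
  exact this.resolve_right hα

omit [DecidableEq σ] in
/-- A form whose monomials are `q`-th powers of variables is `Σ_i c_i x_i^q`. [folklore] -/
theorem eq_sum_X_pow_of_support_subset_single {q : ℕ} (hq : 0 < q) {f : MvPolynomial σ K}
    (h : ∀ α ∈ f.support, ∃ i, α = Finsupp.single i q) :
    f = ∑ i, C (coeff (Finsupp.single i q) f) * X i ^ q := by
  classical
  ext γ
  rw [coeff_sum]
  simp_rw [coeff_C_mul, coeff_X_pow]
  by_cases hγ : ∃ i, γ = Finsupp.single i q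
  · obtain ⟨i, rfl⟩ := hγ
    rw [Finset.sum_eq_single i (fun j _ hj => ?_) (fun h => absurd (Finset.mem_univ i) h), if_pos rfl,
      mul_one]
    rw [if_neg (fun h => hj (Finsupp.single_left_injective hq.ne' h)), mul_zero]
  · rw [Finset.sum_eq_zero (fun j _ => ?_)]
    · exact notMem_support_iff.mp fun hm => hγ (h γ hm)
    · rw [if_neg (fun h' => hγ ⟨j, h'.symm⟩), mul_zero]

omit [DecidableEq σ] in
/-- Over a perfect field, `Σ_i c_i x_i^{p^e} = (Σ_i c_i^{1/p^e} x_i)^{p^e}`. [folklore] -/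
theorem sum_C_mul_X_pow_eq_linearForm_pow (p : ℕ) [ExpChar K p] [PerfectRing K p] (e : ℕ)
    (c' : σ → K) :
    ∑ i, C (c' i) * X i ^ p ^ e =
      linearForm K (fun i => (iterateFrobeniusEquiv K p e).symm (c' i)) ^ p ^ e := by
  rw [linearForm, sum_pow_char_pow]
  refine Finset.sum_congr rfl fun i _ => ?_
  rw [mul_pow, ← map_pow, ← iterateFrobeniusEquiv_def K p e, RingEquiv.apply_symm_apply]

/-! ### Peeling off the variable `x_{i₀}` once `x_{i₀}^q ∈ U` -/

omit [Fintype σ] in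
/-- **Key lemma 3.** If `U` is differentially stable with no forms in degrees `0 < d < p^e`,
then `x_{i₀}` occurs in the forms of `U` only with exponents divisible by `p^e`.
[cite: Kawanoue2007, Lemma 3.1.2.1 (proof)] -/
theorem dvd_of_mem_support_of_minDeg (p : ℕ) [ExpChar K p] {U : Subalgebra K (MvPolynomial σ K)}
    (hUd : IsDiffStable U) (i₀ : σ) {e : ℕ}
    (hmin : ∀ d, 0 < d → d < p ^ e → ∀ g ∈ U, g.IsHomogeneous d → g = 0) :
    ∀ (d : ℕ), ∀ f ∈ U, f.IsHomogeneous d → ∀ α ∈ f.support, p ^ e ∣ α i₀ := by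
  have hq : 0 < p ^ e := pow_pos (expChar_pos K p) e
  intro d
  induction d using Nat.strong_induction_on with
  | _ d ih =>
  intro f hf hfh α hα
  by_contra hndvd
  have hdeg : α.degree = d := degree_eq_of_mem_support hfh hα
  have hcα : coeff α f ≠ 0 := mem_support_iff.mp hα
  by_cases hA : ∃ j, j ≠ i₀ ∧ α j ≠ 0
  · obtain ⟨j, hji, hj⟩ := hA
    have hD := hUd f hf (Finsupp.single j (α j))
    have hDh := isHomogeneous_hasseDeriv_single K hfh j (α j)
    have hmem : α.erase j ∈ (hasseDeriv K (Finsupp.single j (α j)) f).support := by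
      rw [mem_support_iff, coeff_hasseDeriv_single, Finsupp.erase_same, zero_add, Nat.choose_self,
        Nat.cast_one, one_mul, Finsupp.erase_add_single]
      exact hcα
    have hlt : d - α j < d := by
      have := Finsupp.le_degree j α
      omega
    have := ih (d - α j) hlt _ hD hDh (α.erase j) hmem
    rw [Finsupp.erase_ne (Ne.symm hji)] at this
    exact hndvd this
  · push Not at hA
    have hαe : α = Finsupp.single i₀ (α i₀) := by
      ext j
      by_cases hj : j = i₀
      · subst hj; rw [Finsupp.single_eq_same]
      · rw [hA j hj, Finsupp.single_apply, if_neg (Ne.symm hj)]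
    set m := α i₀ with hm
    have hd : d = m := by rw [← hdeg, hαe, Finsupp.degree_single]
    set a := m / p ^ e with ha
    set b := m % p ^ e with hb
    have hb0 : 0 < b := Nat.pos_of_ne_zero fun h => hndvd (Nat.dvd_of_mod_eq_zero h)
    have hbq : b < p ^ e := Nat.mod_lt _ hq
    have hmab : b + p ^ e * a = m := Nat.mod_add_div m (p ^ e)
    have hD := hUd f hf (Finsupp.single i₀ (p ^ e * a))
    have hDh : (hasseDeriv K (Finsupp.single i₀ (p ^ e * a)) f).IsHomogeneous b := by
      have h1 := isHomogeneous_hasseDeriv_single K hfh i₀ (p ^ e * a)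
      have h2 : d - p ^ e * a = b := by omega
      rwa [h2] at h1
    have hzero := hmin b hb0 hbq _ hD hDh
    have := congr_arg (coeff (Finsupp.single i₀ b)) hzero
    have hidx : Finsupp.single i₀ (b + p ^ e * a) = α := by rw [hmab, hαe]
    rw [coeff_hasseDeriv_single, coeff_zero, Finsupp.single_eq_same, ← Finsupp.single_add, hidx,
      mul_eq_zero] at this
    rcases this with h | h
    · rw [add_comm] at h
      exact cast_choose_pow_mul_add_ne_zero K p hbq h
    · exact hcα h

omit [Fintype σ] in
/-- Key lemma 3 for arbitrary (not necessarily homogeneous) elements of a graded `U`.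
[cite: Kawanoue2007, Lemma 3.1.2.1 (proof)] -/
theorem dvd_of_mem_support_of_minDeg' (p : ℕ) [ExpChar K p] {U : Subalgebra K (MvPolynomial σ K)}
    (hUg : IsGradedSubalgebra U) (hUd : IsDiffStable U) (i₀ : σ) {e : ℕ}
    (hmin : ∀ d, 0 < d → d < p ^ e → ∀ g ∈ U, g.IsHomogeneous d → g = 0) :
    ∀ f ∈ U, ∀ α ∈ f.support, p ^ e ∣ α i₀ := by
  intro f hf α hα
  refine dvd_of_mem_support_of_minDeg p hUd i₀ hmin α.degree _ (hUg f hf _)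
    (homogeneousComponent_isHomogeneous _ f) α ?_
  rw [mem_support_iff, coeff_homogeneousComponent, if_pos rfl]
  exact mem_support_iff.mp hα

omit [Fintype σ] in
/-- **Key lemma 4 (peeling off `x_{i₀}`).** If `U` is graded and differentially stable,
`x_{i₀}^{p^e} ∈ U`, and `U` has no forms in degrees `0 < d < p^e`, then `U` is generated by
`x_{i₀}^{p^e}` together with its elements not involving `x_{i₀}`.
[cite: Kawanoue2007, Lemma 3.1.2.1 (proof)] -/
theorem le_adjoin_insert_X_pow_of_minDeg (p : ℕ) [ExpChar K p]
    {U : Subalgebra K (MvPolynomial σ K)} (hUg : IsGradedSubalgebra U) (hUd : IsDiffStable U)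
    {i₀ : σ} {e : ℕ} (hX : X i₀ ^ p ^ e ∈ U)
    (hmin : ∀ d, 0 < d → d < p ^ e → ∀ g ∈ U, g.IsHomogeneous d → g = 0) :
    U ≤ Algebra.adjoin K (insert (X i₀ ^ p ^ e) {g | g ∈ U ∧ i₀ ∉ g.vars}) := by
  set A := Algebra.adjoin K (insert (X i₀ ^ p ^ e) {g | g ∈ U ∧ i₀ ∉ g.vars}) with hA
  have hdiv := dvd_of_mem_support_of_minDeg' p hUg hUd i₀ hmin
  suffices h : ∀ n, ∀ f ∈ U, f.degreeOf i₀ ≤ n → f ∈ A from fun f hf => h _ f hf le_rfl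
  intro n
  induction n with
  | zero =>
    intro f hf hdeg
    have ht : ∀ α ∈ f.support, α i₀ ≤ 0 := fun α hα => (monomial_le_degreeOf i₀ hα).trans hdeg
    have hf0 : f = coeffX K i₀ 0 f := by
      rw [← sub_eq_zero]
      ext α
      have h := coeff_sub_X_pow_mul_coeffX K i₀ 0 f α
      rw [pow_zero, one_mul] at h
      rw [h, coeff_zero]
      split_ifs with h0
      · rfl
      · exact notMem_support_iff.mp fun hα => h0 (Nat.le_zero.mp (ht α hα))
    have hfT : f ∈ {g | g ∈ U ∧ i₀ ∉ g.vars} :=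
      ⟨hf, by rw [hf0]; exact notMem_vars_coeffX K i₀ 0 f⟩
    exact Algebra.subset_adjoin (Set.mem_insert_of_mem _ hfT)
  | succ n ih =>
    intro f hf hdeg
    by_cases hle : f.degreeOf i₀ ≤ n
    · exact ih f hf hle
    have ht : f.degreeOf i₀ = n + 1 := by omega
    have htop : ∀ α ∈ f.support, α i₀ ≤ n + 1 :=
      fun α hα => (monomial_le_degreeOf i₀ hα).trans hdeg
    -- the top coefficient `g` is in `U` (it is a Hasse–Schmidt derivative of `f`) and free of `x_{i₀}`
    have hgU : coeffX K i₀ (n + 1) f ∈ U := by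
      rw [← hasseDeriv_single_eq_coeffX K i₀ (n + 1) htop]; exact hUd f hf _
    have hgA : coeffX K i₀ (n + 1) f ∈ A :=
      Algebra.subset_adjoin (Set.mem_insert_of_mem _ ⟨hgU, notMem_vars_coeffX K i₀ (n + 1) f⟩)
    -- `p^e ∣ n + 1`, an exponent of `x_{i₀}` that occurs in `f`
    have hdvd : p ^ e ∣ n + 1 := by
      have hne : f.support.Nonempty := by
        rw [Finset.nonempty_iff_ne_empty, Ne, support_eq_empty]
        rintro rfl
        rw [degreeOf_zero] at ht
        omega
      obtain ⟨α, hα, hαt⟩ := Finset.exists_mem_eq_sup _ hne (fun m : σ →₀ ℕ => m i₀)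
      rw [← degreeOf_eq_sup, ht] at hαt
      rw [hαt]
      exact hdiv f hf α hα
    obtain ⟨c, hc⟩ := hdvd
    have hXt : X i₀ ^ (n + 1) ∈ U := by rw [hc, pow_mul]; exact pow_mem hX c
    have hXtA : X i₀ ^ (n + 1) ∈ A := by
      rw [hc, pow_mul]; exact pow_mem (Algebra.subset_adjoin (Set.mem_insert _ _)) c
    -- peel off the top layer and conclude by induction
    have hf'U : f - X i₀ ^ (n + 1) * coeffX K i₀ (n + 1) f ∈ U := sub_mem hf (mul_mem hXt hgU)
    have hf'deg : (f - X i₀ ^ (n + 1) * coeffX K i₀ (n + 1) f).degreeOf i₀ ≤ n := by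
      have : (f - X i₀ ^ (n + 1) * coeffX K i₀ (n + 1) f).degreeOf i₀ < n + 1 := by
        rw [degreeOf_lt_iff (by omega)]
        intro α hα
        rw [mem_support_iff, coeff_sub_X_pow_mul_coeffX] at hα
        split_ifs at hα with hαt
        · exact absurd rfl hα
        · exact lt_of_le_of_ne (htop α (mem_support_iff.mpr hα)) hαt
      omega
    have hf'A := ih _ hf'U hf'deg
    have : f = (f - X i₀ ^ (n + 1) * coeffX K i₀ (n + 1) f) + X i₀ ^ (n + 1) * coeffX K i₀ (n + 1) f := by
      ring
    rw [this]
    exact add_mem hf'A (mul_mem hXtA hgA)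

/-! ### The structure theorem -/

/-- **Main induction** (on the set `S` of variables allowed): a graded, differentially stable
`K`-subalgebra of `K[x_j : j ∈ S]`, `K` perfect of exponential characteristic `p`, is generated by
`p`-power powers `ℓ_j^{p^{e_j}}` of `K`-linearly independent linear forms `ℓ_j` in the `x_j`,
`j ∈ S`. [cite: Kawanoue2007, Lemma 3.1.2.1] [cite: Hironaka1970AdditiveGroups] -/
theorem exists_adjoin_pow_linearForm_eq_aux (p : ℕ) [ExpChar K p] [PerfectRing K p] (S : Finset σ) :
    ∀ (U : Subalgebra K (MvPolynomial σ K)), IsGradedSubalgebra U → IsDiffStable U →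
      U ≤ supported K (↑S : Set σ) →
      ∃ (r : ℕ) (ℓ : Fin r → MvPolynomial σ K) (e : Fin r → ℕ),
        (∀ j, ℓ j ∈ Submodule.span K (X '' (↑S : Set σ) : Set (MvPolynomial σ K))) ∧
        LinearIndependent K ℓ ∧ U = Algebra.adjoin K (Set.range fun j => ℓ j ^ p ^ e j) := by
  induction S using Finset.strongInduction with
  | H S ih =>
  intro U hUg hUd hUS
  have hp : 0 < p := expChar_pos K p
  by_cases hbot : U ≤ ⊥
  · refine ⟨0, Fin.elim0, Fin.elim0, fun j => j.elim0, linearIndependent_empty_type, ?_⟩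
    rw [Set.range_eq_empty, Algebra.adjoin_empty]
    exact le_antisymm hbot bot_le
  -- a non-constant element of `U`, hence (gradedness) a nonzero form of positive degree in `U`
  obtain ⟨f, hfU, hfbot⟩ := SetLike.not_le_iff_exists.mp hbot
  have hex : ∃ d, 0 < d ∧ ∃ g ∈ U, g.IsHomogeneous d ∧ g ≠ 0 := by
    by_contra hne
    push Not at hne
    apply hfbot
    have hfC : f = C (coeff 0 f) := by
      conv_lhs => rw [← sum_homogeneousComponent f]
      rw [Finset.sum_eq_single 0, homogeneousComponent_zero]
      · intro d _ hd
        exact hne d (Nat.pos_of_ne_zero hd) _ (hUg f hfU d) (homogeneousComponent_isHomogeneous d f)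
      · intro h; simp at h
    rw [hfC, ← MvPolynomial.algebraMap_eq]
    exact Subalgebra.algebraMap_mem _ _
  -- the least positive degree `q` in which `U` has a nonzero form `g₀`
  classical
  obtain ⟨q, ⟨hq, g₀, hg₀U, hg₀h, hg₀0⟩, hqmin⟩ : ∃ q, (0 < q ∧ ∃ g ∈ U, g.IsHomogeneous q ∧ g ≠ 0) ∧
      ∀ d < q, ¬ (0 < d ∧ ∃ g ∈ U, g.IsHomogeneous d ∧ g ≠ 0) :=
    ⟨Nat.find hex, Nat.find_spec hex, fun d hd => Nat.find_min hex hd⟩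
  have hmin : ∀ d, 0 < d → d < q → ∀ g ∈ U, g.IsHomogeneous d → g = 0 := by
    intro d hd hdq g hg hgh
    by_contra hg0
    exact hqmin d hdq ⟨hd, g, hg, hgh, hg0⟩
  -- `q = p^e` and `g₀ = (Σ c_i x_i)^q`
  obtain ⟨e, hqe⟩ := exists_eq_pow_of_minDeg p hUd hq hmin hg₀U hg₀h hg₀0
  subst hqe
  have hsupp := support_subset_single_of_minDeg hUd hq hmin hg₀U hg₀h
  set c' : σ → K := fun i => coeff (Finsupp.single i (p ^ e)) g₀ with hc'
  set c : σ → K := fun i => (iterateFrobeniusEquiv K p e).symm (c' i) with hc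
  have hg₀eq : g₀ = linearForm K c ^ p ^ e := by
    rw [eq_sum_X_pow_of_support_subset_single hq hsupp]
    exact sum_C_mul_X_pow_eq_linearForm_pow p e c'
  have c'_zero : ∀ i, i ∉ S → c' i = 0 := by
    intro i hi
    by_contra h
    have hmem : Finsupp.single i (p ^ e) ∈ g₀.support := mem_support_iff.mpr h
    apply hi
    have hvars := mem_supported.mp (hUS hg₀U)
    have : i ∈ (↑g₀.vars : Set σ) := by
      rw [Finset.mem_coe, mem_vars_iff_mem_support]
      exact ⟨_, hmem, by rw [Finsupp.mem_support_iff, Finsupp.single_eq_same]; exact hq.ne'⟩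
    exact hvars this
  have c_zero : ∀ i, i ∉ S → c i = 0 := fun i hi => by
    simp only [hc, c'_zero i hi, map_zero]
  obtain ⟨i₀, hi₀⟩ : ∃ i, c i ≠ 0 := by
    by_contra h
    push Not at h
    apply hg₀0
    rw [hg₀eq, linearForm_eq_zero K c h, zero_pow (pow_pos hp e).ne']
  have hi₀S : i₀ ∈ S := by
    by_contra h
    exact hi₀ (c_zero i₀ h)
  -- normalise: `ℓ = x_{i₀} + Σ_{j ≠ i₀} v_j x_j`, a scalar multiple of `Σ c_i x_i`, with `ℓ^q ∈ U`
  set v : σ → K := Function.update (fun i => c i / c i₀) i₀ 0 with hv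
  have hv0 : v i₀ = 0 := Function.update_self _ _ _
  have hvS : ∀ j, j ∉ S → v j = 0 := by
    intro j hj
    have hj0 : j ≠ i₀ := fun h => hj (h ▸ hi₀S)
    rw [hv, Function.update_of_ne hj0, c_zero j hj, zero_div]
  set ℓ : MvPolynomial σ K := X i₀ + linearForm K v with hℓ
  have hℓc : linearForm K c = C (c i₀) * ℓ := by
    have h1 : linearForm K c = C (c i₀) * linearForm K (fun i => c i / c i₀) := by
      simp only [linearForm, Finset.mul_sum]
      refine Finset.sum_congr rfl fun j _ => ?_
      rw [← mul_assoc, ← map_mul, mul_div_cancel₀ _ hi₀]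
    rw [h1, linearForm_eq_update_add K (fun i => c i / c i₀) i₀, div_self hi₀, map_one, one_mul,
      add_comm]
  have hℓU : ℓ ^ p ^ e ∈ U := by
    have : ℓ ^ p ^ e = C ((c i₀)⁻¹ ^ p ^ e) * g₀ := by
      rw [hg₀eq, hℓc, mul_pow, ← mul_assoc, ← map_pow, ← map_mul, ← mul_pow, inv_mul_cancel₀ hi₀,
        one_pow, map_one, one_mul]
    rw [this, ← MvPolynomial.algebraMap_eq]
    exact mul_mem (Subalgebra.algebraMap_mem _ _) hg₀U
  -- the tilt `ψ : ℓ ↦ x_{i₀}` and `U₁ = ψ(U) ∋ x_{i₀}^q`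
  have hψℓ : tilt K i₀ (-v) ℓ = X i₀ := by
    rw [hℓ, map_add, tilt_X_self, tilt_linearForm K i₀ (-v) v hv0, linearForm_neg]
    abel
  set U₁ := U.map (tilt K i₀ (-v)) with hU₁
  have hU₁g : IsGradedSubalgebra U₁ := hUg.map_lsubst _
  have hU₁d : IsDiffStable U₁ := hUd.map_lsubst _
  have hU₁S : U₁ ≤ supported K (↑S : Set σ) := by
    intro g hg
    obtain ⟨f, hf, rfl⟩ := Subalgebra.mem_map.mp hg
    exact tilt_mem_supported K i₀ (-v) (fun j hj => by rw [Pi.neg_apply, hvS j hj, neg_zero])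
      (hUS hf)
  have hX : X i₀ ^ p ^ e ∈ U₁ := by
    rw [← hψℓ, ← map_pow]
    exact Subalgebra.mem_map.mpr ⟨_, hℓU, rfl⟩
  have hmin₁ : ∀ d, 0 < d → d < p ^ e → ∀ g ∈ U₁, g.IsHomogeneous d → g = 0 :=
    minDeg_map_lsubst hUg (tiltMatrix K i₀ (-v)) hmin
  -- peel off `x_{i₀}`: `U₁ = K[x_{i₀}^q, U₂]` with `U₂ = U₁ ∩ K[x_j : j ∈ S \ {i₀}]`
  have hpeel := le_adjoin_insert_X_pow_of_minDeg p hU₁g hU₁d hX hmin₁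
  set U₂ := U₁ ⊓ supported K (↑(S.erase i₀) : Set σ) with hU₂
  obtain ⟨r, ℓ', e', hℓ'S, hℓ'li, hU₂eq⟩ := ih (S.erase i₀) (Finset.erase_ssubset hi₀S) U₂
    (hU₁g.inf_supported _) (hU₁d.inf_supported _) inf_le_right
  have hT : {g | g ∈ U₁ ∧ i₀ ∉ g.vars} ⊆ (U₂ : Set (MvPolynomial σ K)) := by
    rintro g ⟨hg, hgi⟩
    refine Algebra.mem_inf.mpr ⟨hg, ?_⟩
    rw [mem_supported]
    intro j hj
    have hjS := mem_supported.mp (hU₁S hg) hj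
    rw [Finset.coe_erase]
    exact ⟨hjS, fun h => hgi (by rw [Set.mem_singleton_iff] at h; exact h ▸ hj)⟩
  have hU₁eq : U₁ = Algebra.adjoin K (insert (X i₀ ^ p ^ e) (Set.range fun j => ℓ' j ^ p ^ e' j)) := by
    apply le_antisymm
    · refine hpeel.trans ?_
      have hins : Algebra.adjoin K (insert (X i₀ ^ p ^ e) (Set.range fun j => ℓ' j ^ p ^ e' j)) =
          Algebra.adjoin K (insert (X i₀ ^ p ^ e) (U₂ : Set (MvPolynomial σ K))) := by
        rw [hU₂eq, Algebra.adjoin_insert_adjoin]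
      rw [hins]
      exact Algebra.adjoin_mono (Set.insert_subset_insert hT)
    · rw [Algebra.adjoin_le_iff]
      rintro g (rfl | ⟨j, rfl⟩)
      · exact hX
      · have : ℓ' j ^ p ^ e' j ∈ U₂ := by rw [hU₂eq]; exact Algebra.subset_adjoin ⟨j, rfl⟩
        exact (Algebra.mem_inf.mp this).1
  -- the `ℓ'_j` do not involve `x_{i₀}`; pull back by `ψ⁻¹ = tilt v`
  have hℓ'sup : ∀ j, ℓ' j ∈ supported K (↑(S.erase i₀) : Set σ) := by
    intro j
    have hle : Submodule.span K (X '' (↑(S.erase i₀) : Set σ) : Set (MvPolynomial σ K)) ≤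
        Subalgebra.toSubmodule (supported K (↑(S.erase i₀) : Set σ)) := by
      rw [Submodule.span_le]
      rintro _ ⟨k, hk, rfl⟩
      exact Algebra.subset_adjoin ⟨k, hk, rfl⟩
    exact hle (hℓ'S j)
  have hℓ'vars : ∀ j, i₀ ∉ (ℓ' j).vars := by
    intro j hmem
    have := mem_supported.mp (hℓ'sup j) hmem
    simp at this
  have hUeq : U = U₁.map (tilt K i₀ v) := by
    rw [hU₁, Subalgebra.map_map, tilt_comp_tilt_neg K i₀ v hv0, Subalgebra.map_id]
  refine ⟨r + 1, Fin.cons ℓ ℓ', Fin.cons e e', ?_, ?_, ?_⟩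
  · -- the forms lie in the span of the `x_j`, `j ∈ S`
    refine Fin.cases ?_ (fun j => ?_)
    · rw [Fin.cons_zero]
      exact add_mem (Submodule.subset_span ⟨i₀, hi₀S, rfl⟩) (linearForm_mem_span K v _ hvS)
    · rw [Fin.cons_succ]
      exact Submodule.span_mono
        (Set.image_mono (Finset.coe_subset.mpr (Finset.erase_subset i₀ S))) (hℓ'S j)
  · -- linear independence: `ℓ` has `x_{i₀}`-coefficient `1`, the `ℓ'_j` have `x_{i₀}`-coefficient `0`
    rw [linearIndependent_finCons]
    refine ⟨hℓ'li, fun hmem => ?_⟩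
    have hspan : Submodule.span K (Set.range ℓ') ≤
        Subalgebra.toSubmodule (supported K (↑(S.erase i₀) : Set σ)) := by
      rw [Submodule.span_le]
      rintro _ ⟨j, rfl⟩
      exact hℓ'sup j
    have hℓsup : ℓ ∈ supported K (↑(S.erase i₀) : Set σ) := hspan hmem
    have h1 : coeff (Finsupp.single i₀ 1) ℓ = 1 := by
      rw [hℓ, coeff_add, coeff_X, if_pos rfl, coeff_single_linearForm, hv0, add_zero]
    have hi₀vars : i₀ ∈ ℓ.vars := by
      rw [mem_vars_iff_mem_support]
      refine ⟨Finsupp.single i₀ 1, ?_, by simp⟩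
      rw [mem_support_iff, h1]
      exact one_ne_zero
    have := mem_supported.mp hℓsup hi₀vars
    simp at this
  · -- `U = K[ℓ^q, ℓ'_j^{q_j}]`
    rw [hUeq, hU₁eq, AlgHom.map_adjoin, Set.image_insert_eq, map_pow, tilt_X_self]
    have hrange : ⇑(tilt K i₀ v) '' (Set.range fun j => ℓ' j ^ p ^ e' j) =
        Set.range fun j => ℓ' j ^ p ^ e' j := by
      ext g
      constructor
      · rintro ⟨_, ⟨j, rfl⟩, rfl⟩
        exact ⟨j, by simp only [map_pow, tilt_eq_self_of_notMem_vars K i₀ v (hℓ'vars j)]⟩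
      · rintro ⟨j, rfl⟩
        exact ⟨_, ⟨j, rfl⟩, by simp only [map_pow, tilt_eq_self_of_notMem_vars K i₀ v (hℓ'vars j)]⟩
    rw [hrange]
    have hfun : (fun j : Fin (r + 1) =>
        (Fin.cons ℓ ℓ' : Fin (r + 1) → MvPolynomial σ K) j ^ p ^ (Fin.cons e e' : Fin (r + 1) → ℕ) j) =
        (Fin.cons (ℓ ^ p ^ e) (fun j => ℓ' j ^ p ^ e' j) : Fin (r + 1) → MvPolynomial σ K) := by
      funext j
      refine Fin.cases ?_ (fun j => ?_) j
      · simp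
      · simp
    rw [hfun, Fin.range_cons]

omit [Fintype σ] [DecidableEq σ] in
/-- Linear forms: the elements of the `K`-span of the variables are homogeneous of degree `1`.
[folklore] -/
theorem isHomogeneous_one_of_mem_span {f : MvPolynomial σ K}
    (hf : f ∈ Submodule.span K (Set.range (X : σ → MvPolynomial σ K))) : f.IsHomogeneous 1 := by
  have : Submodule.span K (Set.range (X : σ → MvPolynomial σ K)) ≤ homogeneousSubmodule σ K 1 := by
    rw [Submodule.span_le]
    rintro _ ⟨i, rfl⟩
    exact isHomogeneous_X K i
  exact this hf

/-- **Structure theorem for graded, differentially stable subalgebras of a polynomial ring over a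
perfect field** (Hironaka 1970; Giraud 1975; Oda; Kawanoue 2007, Lemma 3.1.2.1): if `K` is a
perfect field of exponential characteristic `p` and `U ⊆ K[x_1, …, x_n]` is a graded
`K`-subalgebra stable under all Hasse–Schmidt derivations `D^{(β)}`, then
`U = K[ℓ_1^{p^{e_1}}, …, ℓ_r^{p^{e_r}}]` for `K`-linearly independent linear forms `ℓ_j` and
exponents `e_1 ≤ … ≤ e_r` (in characteristic `0`, `p = 1` and `U = K[ℓ_1, …, ℓ_r]`).
[cite: Kawanoue2007, Lemma 3.1.2.1] [cite: Hironaka1970AdditiveGroups]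
[cite: Giraud1975, §1.6 (3)] -/
theorem exists_eq_adjoin_pow_linearForms_of_isDiffStable (p : ℕ) [ExpChar K p] [PerfectRing K p]
    (U : Subalgebra K (MvPolynomial σ K)) (hUg : IsGradedSubalgebra U) (hUd : IsDiffStable U) :
    ∃ (r : ℕ) (ℓ : Fin r → MvPolynomial σ K) (e : Fin r → ℕ),
      (∀ j, ℓ j ∈ Submodule.span K (Set.range (X : σ → MvPolynomial σ K))) ∧
      LinearIndependent K ℓ ∧ Monotone e ∧
      U = Algebra.adjoin K (Set.range fun j => ℓ j ^ p ^ e j) := by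
  obtain ⟨r, ℓ, e, hℓ, hli, hU⟩ := exists_adjoin_pow_linearForm_eq_aux p Finset.univ U hUg hUd
    (by rw [Finset.coe_univ, supported_univ]; exact le_top)
  -- sort the exponents
  let s := Tuple.sort e
  refine ⟨r, ℓ ∘ s, e ∘ s, fun j => ?_, hli.comp _ s.injective, Tuple.monotone_sort e, ?_⟩
  · rw [Finset.coe_univ, Set.image_univ] at hℓ
    exact hℓ (s j)
  · rw [hU]
    congr 1
    exact ((Equiv.surjective s).range_comp (fun j => ℓ j ^ p ^ e j)).symm

/-- **Structure theorem, counted form**: at most `n = #σ` generators `ℓ_j^{p^{e_j}}`, the `ℓ_j`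
linearly independent forms of degree `1`, exponents sorted.
[cite: Kawanoue2007, Lemma 3.1.2.1] [cite: Hironaka1970AdditiveGroups] -/
theorem exists_eq_adjoin_pow_linearForms_of_isDiffStable' (p : ℕ) [ExpChar K p] [PerfectRing K p]
    (U : Subalgebra K (MvPolynomial σ K)) (hUg : IsGradedSubalgebra U) (hUd : IsDiffStable U) :
    ∃ (r : ℕ) (ℓ : Fin r → MvPolynomial σ K) (e : Fin r → ℕ),
      r ≤ Fintype.card σ ∧ (∀ j, (ℓ j).IsHomogeneous 1) ∧
      LinearIndependent K ℓ ∧ Monotone e ∧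
      U = Algebra.adjoin K (Set.range fun j => ℓ j ^ p ^ e j) := by
  obtain ⟨r, ℓ, e, hℓ, hli, hmono, hU⟩ :=
    exists_eq_adjoin_pow_linearForms_of_isDiffStable p U hUg hUd
  refine ⟨r, ℓ, e, ?_, fun j => isHomogeneous_one_of_mem_span (hℓ j), hli, hmono, hU⟩
  -- `r` independent vectors in the span of the `n` variables
  let W := Submodule.span K (Set.range (X : σ → MvPolynomial σ K))
  let ℓW : Fin r → W := fun j => ⟨ℓ j, hℓ j⟩
  have hliW : LinearIndependent K ℓW := LinearIndependent.of_comp W.subtype (by exact hli)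
  haveI : Module.Finite K W := Module.Finite.span_of_finite K (Set.finite_range _)
  calc r = Fintype.card (Fin r) := (Fintype.card_fin r).symm
    _ ≤ Module.finrank K W := hliW.fintype_card_le_finrank
    _ ≤ Fintype.card σ := finrank_range_le_card _

/-- **Structure theorem in `K[x_1, …, x_n]`** (the form used for the ridge / Hironaka's additive
group scheme `B_U = Spec K[x]/(U_+)`, cf. `Ridge.lean`, "What is NOT here"): a graded
`K`-subalgebra of `K[x_1, …, x_n]`, `K` perfect, stable under all Hasse–Schmidt derivations is
`K[ℓ_1^{q_1}, …, ℓ_r^{q_r}]`, `r ≤ n`, with `K`-linearly independent linear forms `ℓ_j` and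
`p`-powers `q_1 ≤ … ≤ q_r` (`q_j = p^{e_j}`, `p` the exponential characteristic).
[cite: Kawanoue2007, Lemma 3.1.2.1] [cite: Hironaka1970AdditiveGroups]
[cite: Giraud1975, §1.6 (3)] -/
theorem exists_eq_adjoin_pow_linearForms_of_isDiffStable_fin {n : ℕ} (p : ℕ) [ExpChar K p]
    [PerfectRing K p] (U : Subalgebra K (MvPolynomial (Fin n) K)) (hUg : IsGradedSubalgebra U)
    (hUd : IsDiffStable U) :
    ∃ (r : ℕ) (ℓ : Fin r → MvPolynomial (Fin n) K) (e : Fin r → ℕ),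
      r ≤ n ∧ (∀ j, ℓ j ∈ homogeneousSubmodule (Fin n) K 1) ∧
      LinearIndependent K ℓ ∧ Monotone e ∧
      U = Algebra.adjoin K (Set.range fun j => ℓ j ^ p ^ e j) := by
  obtain ⟨r, ℓ, e, hr, hℓ, hli, hmono, hU⟩ :=
    exists_eq_adjoin_pow_linearForms_of_isDiffStable' p U hUg hUd
  exact ⟨r, ℓ, e, by simpa using hr, fun j => (mem_homogeneousSubmodule 1 (ℓ j)).mpr (hℓ j), hli,
    hmono, hU⟩

end Structure

end Literature.AlgebraicGeometry.Resolution
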